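import Summits.ValiantsHypothesis.ValiantsHypothesis.Theorems.KPlusLogSqLawTropicalBRigidityLaw

/-!
# Route «KPlusLogSqLaw», crux `TropicalB` (stmt-ValiantsHypothesis-19771) — RIGIDITY BUDGET:
# in a rigid design distinct permutations of dominant terms differ by ONE cycle, and each permutation carries at most `K` dominant terms

HONEST FRAMING.  Helper file (cell `pub-symmetroid`, seat val-sym-trop-p1 g32, 2026-08-29) `--supports` the crux
`Summit.ValiantsHypothesis.ValiantsHypothesis.Theses.KPlusLogSqLaw.TropicalB` (item `stmt-ValiantsHypothesis-19771`, registered stubs `stub_tropThin` /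
`stub_tropFat` of `Cruxes/TropicalB/Lines/birth.lean`).  Corollaries of the RIGIDITY LAW (✓ `…TropicalBRigidityLaw`, this seat): all-design structure statements,
def-free; nothing here bounds `TropicalB` in its window or bears on `WeakLifting`, DoorA26 / DoorA34, `MatrixDescartes` (stmt-ValiantsHypothesis-18050) or VP ≠ VNP.

RIGID := every present term is a unique optimum at some integer slope (`hrig : ∀ q, termSign ε q ≠ 0 → ∃ θ : ℤ, IsDominant d v ε θ q`).
* `RigidityBudget.isCycle_quotient` — two dominant terms of a rigid design with different permutations `σ₁ ≠ σ₂` have a quotient `σ₁⁻¹σ₂` that IS A CYCLE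
  (`Equiv.Perm.IsCycle`): the permutations of a rigid design form a family in which every quotient is a single cycle.
* `RigidityBudget.card_le_of_pairwise_single` — combinatorial lemma: a finite family of maps `Fin m → Fin K` any two of which differ in EXACTLY one
  coordinate has at most `K` members (all of them vary one common coordinate).
* `RigidityBudget.card_classes_le` — hence in a rigid design, for every permutation `σ`, any finite family of class maps `λ` with `(σ, λ)` dominant has at most
  `K` members: a rigid design carries at most `K` dominant terms per permutation.
READING.  With the located clique numbers `ω_m` of the Cayley graph (S_m, single cycles) — 2, 6, 6, 13 for m = 2..5 (exact), ≥ 18, ≥ 19 for m = 6, 7; interval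
cycles through a common point give ≈ m²/4 (memo REPORT-g32 §8) — a rigid design of format (m, K) has at most `K·ω_m` dominant terms; e.g. at m = 5 at most
`13·K`, so the counting-tight (5,4) column (56 terms, 37 permutations) is NOT rigid: long chains carry dominated present terms.  [this seat]
-/

set_option linter.dupNamespace false
set_option autoImplicit false

namespace Summit.ValiantsHypothesis.ValiantsHypothesis.Theorems.KPlusLogSqLaw

open Summit.ValiantsHypothesis.ValiantsHypothesis.Theorems.MatrixDescartes.Negative
open Finset

namespace RigidityBudget

variable {m K : ℕ} (d : Fin K → ℕ) (v ε : Fin m → Fin m → Fin K → ℤ)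

/-- **quotients are cycles**: in a rigid design two dominant terms with different permutations differ by a single cycle. [this seat] -/
theorem isCycle_quotient (hrig : ∀ q : Equiv.Perm (Fin m) × (Fin m → Fin K), termSign ε q ≠ 0 → ∃ θ : ℤ, IsDominant d v ε θ q)
    {θ₁ θ₂ : ℤ} {σ₁ σ₂ : Equiv.Perm (Fin m)} {l₁ l₂ : Fin m → Fin K}
    (h₁ : IsDominant d v ε θ₁ (σ₁, l₁)) (h₂ : IsDominant d v ε θ₂ (σ₂, l₂)) (hne : σ₁ ≠ σ₂) :
    (σ₁⁻¹ * σ₂).IsCycle := by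
  -- a moved column exists, and every moved column lies on its cycle
  have hmoved : ∀ b, (σ₁⁻¹ * σ₂) b ≠ b ↔ σ₁ b ≠ σ₂ b := by
    intro b
    rw [Equiv.Perm.mul_apply, ne_eq, Equiv.Perm.inv_eq_iff_eq, ne_eq]
    exact ⟨fun h h' => h h'.symm, fun h h' => h h'.symm⟩
  obtain ⟨b₀, hb₀⟩ : ∃ b, σ₁ b ≠ σ₂ b := by
    by_contra h
    push Not at h
    exact hne (Equiv.ext h)
  refine ⟨b₀, (hmoved b₀).mpr hb₀, fun b hb => ?_⟩
  exact RigidityLaw.sameCycle d v ε hrig h₁ h₂ (Or.inl hb₀) (Or.inl ((hmoved b).mp hb))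

/-- **combinatorial lemma**: a finite family of maps `Fin m → Fin K`, any two distinct members of which differ in exactly one coordinate, has at most `K`
members. [folklore] -/
theorem card_le_of_pairwise_single (hK : 1 ≤ K) (S : Finset (Fin m → Fin K))
    (hS : ∀ f ∈ S, ∀ g ∈ S, f ≠ g → ∃ i, f i ≠ g i ∧ ∀ j, j ≠ i → f j = g j) : S.card ≤ K := by
  classical
  rcases S.eq_empty_or_nonempty with h | ⟨u, hu⟩
  · simp [h]
  by_cases hone : S = {u}
  · rw [hone, card_singleton]; exact hK
  · -- a second member `w ≠ u`, differing from `u` exactly at coordinate `i`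
    obtain ⟨w, hw, hwu⟩ : ∃ w ∈ S, w ≠ u := by
      by_contra h
      push Not at h
      exact hone (eq_singleton_iff_unique_mem.mpr ⟨hu, h⟩)
    obtain ⟨i, hi, hoff⟩ := hS w hw u hu hwu
    -- every member agrees with `u` off `i`
    have hagree : ∀ z ∈ S, ∀ j, j ≠ i → z j = u j := by
      intro z hz j hj
      by_cases hzu : z = u
      · rw [hzu]
      obtain ⟨i', hi', hoff'⟩ := hS z hz u hu hzu
      by_cases hii : i' = i
      · subst hii; exact hoff' j hj
      · -- then `z` and `w` would differ at `i` and at `i'`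
        exfalso
        have hzw : z ≠ w := by
          intro h; rw [h] at hi'; exact hi' (hoff i' hii)
        obtain ⟨k, _, hoffk⟩ := hS z hz w hw hzw
        have hzi : z i = u i := hoff' i (fun h => hii h.symm)
        have hdi : z i ≠ w i := by rw [hzi]; exact fun h => hi h.symm
        have hdi' : z i' ≠ w i' := by rw [hoff i' hii]; exact hi'
        have hki : k = i := by by_contra h; exact hdi (hoffk i (fun h' => h h'.symm))
        have hki' : k = i' := by by_contra h; exact hdi' (hoffk i' (fun h' => h h'.symm))
        exact hii (hki'.symm.trans hki)
    -- so evaluation at `i` is injective on `S`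
    have hinj : Set.InjOn (fun z : Fin m → Fin K => z i) S := by
      intro z hz z' hz' h
      funext j
      by_cases hj : j = i
      · subst hj; exact h
      · rw [hagree z hz j hj, hagree z' hz' j hj]
    calc S.card = (S.image fun z => z i).card := (card_image_of_injOn hinj).symm
      _ ≤ (univ : Finset (Fin K)).card := card_le_card (subset_univ _)
      _ = K := by simp

/-- **at most `K` dominant terms per permutation**: in a rigid design, a finite family of class maps `λ` with `(σ, λ)` dominant (each at some slope) has
at most `K` members. [this seat] -/
theorem card_classes_le (hK : 1 ≤ K)
    (hrig : ∀ q : Equiv.Perm (Fin m) × (Fin m → Fin K), termSign ε q ≠ 0 → ∃ θ : ℤ, IsDominant d v ε θ q)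
    (σ : Equiv.Perm (Fin m)) (L : Finset (Fin m → Fin K)) (hL : ∀ l ∈ L, ∃ θ : ℤ, IsDominant d v ε θ (σ, l)) : L.card ≤ K := by
  refine card_le_of_pairwise_single hK L fun f hf g hg hfg => ?_
  obtain ⟨θ₁, h₁⟩ := hL f hf
  obtain ⟨θ₂, h₂⟩ := hL g hg
  obtain ⟨i, hi⟩ : ∃ i, f i ≠ g i := by
    by_contra h
    push Not at h
    exact hfg (funext h)
  exact ⟨i, hi, fun j hj => by
    by_contra hne
    exact hj (RigidityLaw.classes_differ_at_most_once d v ε hrig h₁ h₂ hi hne)⟩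

end RigidityBudget

end Summit.ValiantsHypothesis.ValiantsHypothesis.Theorems.KPlusLogSqLaw
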